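import Summits.Langlands.Langlands.Theorems.PicardMuOrdinaryMuOrdinaryFamilyRTPointRoots

/-!
# The Picard point of line `free-seed-smooth-rt` (crux `MuOrdinaryFamilyRT`, stmt-Langlands-13757):
# the Galois image of `Γ_K` on the four roots contains `A₄`

Helper file for the registered stub `stub_point` (plan: `…PointPlan.lean`), Galois half of LEAF
`rbarAbsIrreducible`.  For generic `f` (`12 ∣ #Gal(f/ℚ)`) we PROVE
`alternatingGroup_le_range_toPermHom : alternatingGroup (Roots f) ≤ (Γ_K → Sym(Roots f)).range`:

* `rootPermHom` — the `ℚ`-automorphisms of `K̄` permute the roots of `f ∈ ℤ[X]`; `resQ : Γ_K → Aut_ℚ(K̄)`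
  (restriction of scalars), `toPermHom_eq_comp` — `Γ_K` acts through `rootPermHom ∘ resQ`;
* `range_resQ_eq_ker`, `index_range_resQ` — `resQ(Γ_K)` is the kernel of `Aut_ℚ(K̄) → Gal(K/ℚ)`
  (Mathlib `AlgEquiv.restrictNormalHom`, surjective), of index `[K : ℚ] = φ(3) = 2`;
* `twelve_dvd_card_range_rootPermHom` — through Mathlib's `Polynomial.Gal.restrict` (onto, `K̄/ℚ`
  normal) and the faithful `Polynomial.Gal.galActionHom`, the image of `Aut_ℚ(K̄)` on the roots is a
  copy of `Gal(f/ℚ)`, so `12` divides its order; inside `S₄` (`#Sym(Roots f) = 24`) it has index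
  `∣ 2`, hence contains every `3`-cycle `c = (c²)²` (`Subgroup.mul_self_mem_of_index_two`);
* the image of `Γ_K` has index `∣ 2` in it (`Subgroup.index_map_dvd`), so again contains every
  `3`-cycle, and the `3`-cycles generate `A₄` (`Equiv.Perm.closure_three_cycles_eq_alternating`).
-/

-- `Summit.Langlands.Langlands.…` (summit = sub-problem name, D-0017 layout) trips `dupNamespace` on every decl.
set_option linter.dupNamespace false

namespace Summit.Langlands.Langlands.Cruxes.MuOrdinaryFamilyRT.FreeSeedSmoothRt

open scoped NumberField Polynomial Matrix Classical
open Field IsDedekindDomain Polynomial Finset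
open Literature.NumberTheory.GaloisRepresentations

noncomputable section

/-! ### The Galois image on the four roots contains `A₄` -/

section GaloisImage

variable (f : ℤ[X])

/-- A ring automorphism of `K̄` permutes the roots of `f ∈ ℤ[X]`. -/
theorem ringEquiv_mem_roots_iff (C : AlgebraicClosure K ≃+* AlgebraicClosure K) (α : AlgebraicClosure K) :
    α ∈ (f.map (algebraMap ℤ K)).rootSet (AlgebraicClosure K) ↔
      C α ∈ (f.map (algebraMap ℤ K)).rootSet (AlgebraicClosure K) := by
  have h : ∀ β : AlgebraicClosure K, aeval (C β) (f.map (algebraMap ℤ K)) = C (aeval β (f.map (algebraMap ℤ K))) := fun β => by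
    rw [aeval_map_algebraMap, aeval_map_algebraMap, aeval_def, aeval_def]
    change _ = C.toRingHom (eval₂ (algebraMap ℤ (AlgebraicClosure K)) β f)
    rw [hom_eval₂, RingHom.ext_int (C.toRingHom.comp (algebraMap ℤ (AlgebraicClosure K))) (algebraMap ℤ _)]
    rfl
  simp only [mem_rootSet, h, map_eq_zero_iff _ C.injective]

/-- The permutation of `Roots f` induced by a ring automorphism of `K̄`. -/
def rootPerm (C : AlgebraicClosure K ≃+* AlgebraicClosure K) : Equiv.Perm (Roots f) :=
  C.toEquiv.subtypeEquiv fun α => ringEquiv_mem_roots_iff f C α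

/-- `rootPerm` on underlying elements. -/
@[simp] theorem coe_rootPerm (C : AlgebraicClosure K ≃+* AlgebraicClosure K) (α : Roots f) :
    ((rootPerm f C α : Roots f) : AlgebraicClosure K) = C α := rfl

/-- `rootPerm` as a homomorphism on the `ℚ`-automorphisms of `K̄`. -/
def rootPermHom : (AlgebraicClosure K ≃ₐ[ℚ] AlgebraicClosure K) →* Equiv.Perm (Roots f) where
  toFun τ := rootPerm f τ.toRingEquiv
  map_one' := Equiv.ext fun _ => Subtype.ext rfl
  map_mul' _ _ := Equiv.ext fun _ => Subtype.ext rfl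

/-- The restriction `Γ_K → Aut_ℚ(K̄)`. -/
def resQ : absoluteGaloisGroup K →* (AlgebraicClosure K ≃ₐ[ℚ] AlgebraicClosure K) :=
  haveI : IsScalarTower ℚ K (AlgebraicClosure K) := IsScalarTower.of_algebraMap_eq' (RingHom.ext_rat _ _)
  (AlgEquiv.restrictScalarsHom ℚ).comp (absoluteGaloisGroup.toAlgEquiv K).toMonoidHom

/-- `Γ_K` acts on the roots through `rootPermHom ∘ resQ`. -/
theorem toPermHom_eq_comp : MulAction.toPermHom (absoluteGaloisGroup K) (Roots f) = (rootPermHom f).comp (resQ) := by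
  refine MonoidHom.ext fun σ => Equiv.ext fun α => Subtype.ext ?_
  rfl

/-- The image of `Γ_K` in `Aut_ℚ(K̄)` is the kernel of restriction to `K` (index `[K : ℚ] = 2`). -/
theorem range_resQ_eq_ker :
    haveI : IsScalarTower ℚ K (AlgebraicClosure K) := IsScalarTower.of_algebraMap_eq' (RingHom.ext_rat _ _)
    (resQ).range = (AlgEquiv.restrictNormalHom (F := ℚ) (K₁ := AlgebraicClosure K) K).ker := by
  haveI : IsScalarTower ℚ K (AlgebraicClosure K) := IsScalarTower.of_algebraMap_eq' (RingHom.ext_rat _ _)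
  ext τ
  constructor
  · rintro ⟨σ, rfl⟩
    rw [MonoidHom.mem_ker]
    refine AlgEquiv.ext fun x => (algebraMap K (AlgebraicClosure K)).injective ?_
    change algebraMap K (AlgebraicClosure K) (((resQ σ).restrictNormal K) x) = _
    rw [AlgEquiv.restrictNormal_commutes, AlgEquiv.one_apply]
    exact (absoluteGaloisGroup.toAlgEquiv K σ).commutes x
  · intro hτ
    rw [MonoidHom.mem_ker] at hτ
    have h1 : τ.restrictNormal K = 1 := hτ
    have hfix : ∀ x : K, τ (algebraMap K (AlgebraicClosure K) x) = algebraMap K (AlgebraicClosure K) x := fun x => by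
      have := AlgEquiv.restrictNormal_commutes τ K x
      rw [h1, AlgEquiv.one_apply] at this
      exact this.symm
    let σ : AlgebraicClosure K ≃ₐ[K] AlgebraicClosure K := { τ.toRingEquiv with commutes' := hfix }
    refine ⟨(absoluteGaloisGroup.toAlgEquiv K).symm σ, AlgEquiv.ext fun y => ?_⟩
    rfl

/-- `[Aut_ℚ(K̄) : Γ_K] = 2`. -/
theorem index_range_resQ : (resQ).range.index = 2 := by
  haveI : IsScalarTower ℚ K (AlgebraicClosure K) := IsScalarTower.of_algebraMap_eq' (RingHom.ext_rat _ _)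
  haveI : IsAlgClosure ℚ (AlgebraicClosure K) := IsAlgClosure.ofAlgebraic ℚ K (AlgebraicClosure K)
  haveI := isCyclotomicExtensionK
  rw [range_resQ_eq_ker, Subgroup.index_ker, MonoidHom.range_eq_top_of_surjective _
    (AlgEquiv.restrictNormalHom_surjective (F := ℚ) (K₁ := K) (E := AlgebraicClosure K)), Subgroup.card_top,
    IsGalois.card_aut_eq_finrank, IsCyclotomicExtension.finrank (K := ℚ) (L := K) (n := 3) (cyclotomic.irreducible_rat (by norm_num)),
    Nat.totient_prime Nat.prime_three]

/-- Conjugation of permutations along a bijection, as a group homomorphism. -/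
def permConj {A B : Type*} (ε : A ≃ B) : Equiv.Perm A →* Equiv.Perm B where
  toFun π := (ε.symm.trans π).trans ε
  map_one' := Equiv.ext fun b => by simp
  map_mul' π π' := Equiv.ext fun b => by simp [Equiv.Perm.mul_apply]

/-- `permConj ε π b = ε (π (ε⁻¹ b))`. -/
@[simp] theorem permConj_apply {A B : Type*} (ε : A ≃ B) (π : Equiv.Perm A) (b : B) :
    permConj ε π b = ε (π (ε.symm b)) := rfl

/-- `permConj ε` is injective. -/
theorem permConj_injective {A B : Type*} (ε : A ≃ B) : Function.Injective (permConj ε) := by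
  intro π π' h
  refine Equiv.ext fun a => ε.injective ?_
  have := Equiv.congr_fun h (ε a)
  simpa using this

variable {f} (hgen : Generic f)
include hgen

/-- The roots of `f ⊗ ℚ` in `K̄` are the roots of `f`. -/
theorem mem_rootSet_rat_iff (x : AlgebraicClosure K) :
    x ∈ (f.map (Int.castRingHom ℚ)).rootSet (AlgebraicClosure K) ↔ x ∈ (f.map (algebraMap ℤ K)).rootSet (AlgebraicClosure K) := by
  rw [mem_rootSet, mem_rootSet, aeval_def, aeval_def, eval₂_map, eval₂_map,
    RingHom.ext_int ((algebraMap ℚ (AlgebraicClosure K)).comp (Int.castRingHom ℚ)) (algebraMap ℤ _),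
    RingHom.ext_int ((algebraMap K (AlgebraicClosure K)).comp (algebraMap ℤ K)) (algebraMap ℤ _)]
  have h1 : f.map (Int.castRingHom ℚ) ≠ 0 := (Polynomial.map_ne_zero_iff (Int.castRingHom ℚ).injective_int).mpr (ne_zero_of_generic hgen)
  have h2 : f.map (algebraMap ℤ K) ≠ 0 := (Polynomial.map_ne_zero_iff (algebraMap ℤ K).injective_int).mpr (ne_zero_of_generic hgen)
  simp only [h1, h2, ne_eq, not_false_eq_true, true_and]

/-- The identification of the two root types. -/
def rootSetRatEquiv : (f.map (Int.castRingHom ℚ)).rootSet (AlgebraicClosure K) ≃ Roots f :=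
  Equiv.subtypeEquivRight (mem_rootSet_rat_iff hgen)

/-- **`12 ∣ #(image of Aut_ℚ(K̄) on the roots)`**: the image is `Gal(f/ℚ)` acting faithfully. -/
theorem twelve_dvd_card_range_rootPermHom : 12 ∣ Nat.card (rootPermHom f).range := by
  set p : ℚ[X] := f.map (Int.castRingHom ℚ) with hp
  haveI : Fact ((p.map (algebraMap ℚ (AlgebraicClosure K))).Splits) := ⟨IsAlgClosed.splits _⟩
  haveI : IsScalarTower ℚ K (AlgebraicClosure K) := IsScalarTower.of_algebraMap_eq' (RingHom.ext_rat _ _)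
  haveI : IsAlgClosure ℚ (AlgebraicClosure K) := IsAlgClosure.ofAlgebraic ℚ K (AlgebraicClosure K)
  set ε := rootSetRatEquiv hgen with hε
  have heq : rootPermHom f = (permConj ε).comp ((Polynomial.Gal.galActionHom p (AlgebraicClosure K)).comp
      (Polynomial.Gal.restrict p (AlgebraicClosure K))) := by
    refine MonoidHom.ext fun ϕ => Equiv.ext fun α => Subtype.ext ?_
    rw [MonoidHom.comp_apply, MonoidHom.comp_apply, permConj_apply]
    change ϕ α = ((Polynomial.Gal.galActionHom p (AlgebraicClosure K) (Polynomial.Gal.restrict p (AlgebraicClosure K) ϕ)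
      (ε.symm α) : (f.map (Int.castRingHom ℚ)).rootSet (AlgebraicClosure K)) : AlgebraicClosure K)
    rw [Polynomial.Gal.galActionHom_restrict]
    rfl
  have hrange : (rootPermHom f).range = ((permConj ε).comp (Polynomial.Gal.galActionHom p (AlgebraicClosure K))).range := by
    rw [heq]
    ext π
    simp only [MonoidHom.mem_range, MonoidHom.comp_apply]
    constructor
    · rintro ⟨ϕ, rfl⟩
      exact ⟨Polynomial.Gal.restrict p (AlgebraicClosure K) ϕ, rfl⟩
    · rintro ⟨g, rfl⟩
      obtain ⟨ϕ, rfl⟩ := Polynomial.Gal.restrict_surjective p (AlgebraicClosure K) g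
      exact ⟨ϕ, rfl⟩
  have hinj : Function.Injective ((permConj ε).comp (Polynomial.Gal.galActionHom p (AlgebraicClosure K))) :=
    (permConj_injective ε).comp (Polynomial.Gal.galActionHom_injective p (AlgebraicClosure K))
  rw [hrange, Nat.card_congr (MonoidHom.ofInjective hinj).toEquiv.symm]
  exact hgen.2.2

/-- **Every `3`-cycle of the roots comes from `Aut_ℚ(K̄)`** (the image has index `∣ 2` in `S₄`). -/
theorem mem_range_rootPermHom_of_isThreeCycle {c : Equiv.Perm (Roots f)} (hc : c.IsThreeCycle) :
    c ∈ (rootPermHom f).range := by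
  set H := (rootPermHom f).range with hH
  have hcard : Nat.card (Equiv.Perm (Roots f)) = 24 := by
    rw [Nat.card_eq_fintype_card, Fintype.card_perm, card_roots hgen]; rfl
  obtain ⟨m, hm⟩ := twelve_dvd_card_range_rootPermHom hgen
  have hmul := Subgroup.card_mul_index H
  rw [hcard, hm] at hmul
  have hidx : H.index ∣ 2 := by
    refine Dvd.intro_left m (Nat.eq_of_mul_eq_mul_left (by norm_num : 0 < 12) ?_)
    rw [← mul_assoc, hmul]
  have hc3 : c ^ 3 = 1 := by rw [← hc.orderOf, pow_orderOf_eq_one]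
  have hc4 : c = (c * c) * (c * c) := by
    have h4 : c ^ 4 = (c * c) * (c * c) := by simp only [pow_succ, pow_zero, one_mul, mul_assoc]
    rw [← h4, pow_succ, hc3, one_mul]
  rcases (Nat.dvd_prime Nat.prime_two).mp hidx with h | h
  · rw [Subgroup.index_eq_one] at h
    rw [h]; exact Subgroup.mem_top c
  · rw [hc4]
    exact H.mul_mem (Subgroup.mul_self_mem_of_index_two h c) (Subgroup.mul_self_mem_of_index_two h c)

/-- **Every `3`-cycle of the roots comes from `Γ_K`** (`Γ_K` has index `2` in `Aut_ℚ(K̄)`, and a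
`3`-cycle is the square of its square). -/
theorem mem_range_toPermHom_of_isThreeCycle {c : Equiv.Perm (Roots f)} (hc : c.IsThreeCycle) :
    c ∈ (MulAction.toPermHom (absoluteGaloisGroup K) (Roots f)).range := by
  set ψ := rootPermHom f with hψ
  obtain ⟨τ, hτ⟩ := mem_range_rootPermHom_of_isThreeCycle hgen hc
  set Q : Subgroup ψ.range := (resQ).range.map ψ.rangeRestrict with hQ
  have hQidx : Q.index ∣ 2 := by
    rw [← index_range_resQ]
    exact Subgroup.index_map_dvd _ (MonoidHom.rangeRestrict_surjective ψ)
  set ĉ : ψ.range := ⟨c, τ, hτ⟩ with hĉ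
  have hc3 : c ^ 3 = 1 := by rw [← hc.orderOf, pow_orderOf_eq_one]
  have hĉ3 : ĉ ^ 3 = 1 := Subtype.ext (by rw [SubmonoidClass.coe_pow, hc3]; rfl)
  have hĉ4 : ĉ = (ĉ * ĉ) * (ĉ * ĉ) := by
    have h4 : ĉ ^ 4 = (ĉ * ĉ) * (ĉ * ĉ) := by simp only [pow_succ, pow_zero, one_mul, mul_assoc]
    rw [← h4, pow_succ, hĉ3, one_mul]
  have hĉQ : ĉ ∈ Q := by
    rcases (Nat.dvd_prime Nat.prime_two).mp hQidx with h | h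
    · rw [Subgroup.index_eq_one] at h
      rw [h]; exact Subgroup.mem_top ĉ
    · rw [hĉ4]
      exact Q.mul_mem (Subgroup.mul_self_mem_of_index_two h ĉ) (Subgroup.mul_self_mem_of_index_two h ĉ)
  have hmap : (MulAction.toPermHom (absoluteGaloisGroup K) (Roots f)).range = Q.map ψ.range.subtype := by
    rw [toPermHom_eq_comp, ← MonoidHom.map_range, hQ, Subgroup.map_map, MonoidHom.subtype_comp_rangeRestrict]
  rw [hmap, Subgroup.mem_map]
  exact ⟨ĉ, hĉQ, rfl⟩

/-- **The Galois image of `Γ_K` on the four roots contains `A₄`** for generic `f`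
(`12 ∣ #Gal(f/ℚ)`; `3`-cycles generate `A₄`). -/
theorem alternatingGroup_le_range_toPermHom_of_generic :
    alternatingGroup (Roots f) ≤ (MulAction.toPermHom (absoluteGaloisGroup K) (Roots f)).range := by
  rw [← Equiv.Perm.closure_three_cycles_eq_alternating, Subgroup.closure_le]
  intro c hc
  exact mem_range_toPermHom_of_isThreeCycle hgen hc

omit hgen in
/-- **The Galois image of `Γ_K` on the four roots contains `A₄`** (registered helper goal of
`stub_point`; Galois half of LEAF `rbarAbsIrreducible`). -/
theorem alternatingGroup_le_range_toPermHom : ∀ {f : ℤ[X]}, Generic f → alternatingGroup (Roots f) ≤ (MulAction.toPermHom (absoluteGaloisGroup K) (Roots f)).range :=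
  fun hgen => alternatingGroup_le_range_toPermHom_of_generic hgen

end GaloisImage

end

end Summit.Langlands.Langlands.Cruxes.MuOrdinaryFamilyRT.FreeSeedSmoothRt
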